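import Mathlib
import Summits.ValiantsHypothesis.ValiantsHypothesis.Theorems.FifoMatchingNNDivisionHardPolylogArcFaces
import Summits.ValiantsHypothesis.ValiantsHypothesis.Theorems.FifoMatchingNNDivisionHardSplitFace
import Summits.ValiantsHypothesis.ValiantsHypothesis.Theorems.FifoMatchingNNDivisionHardLinearTransportExplicit
import HarnessLib

/-!
# Route FifoMatching — crux `NNDivisionHard` (stmt-ValiantsHypothesis-21181): LOCAL (BLOCK) NEWTON DIMENSION —
# a certificate has Newton dimension `≥ b / polylog n` INSIDE EVERY aligned block of half-size `b`

`…NewtonDimension` / `…PolylogArcFaces` (this hand): a cofactor whose Newton polytope has dimension `D` with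
`2(D+1)((log₂ n + c + 18)^{6(c+18)} + 3) ≤ n` is not a certificate.  The block transports of `…SplitFace` / `…BlockAvoidance`
(free initial form `top_{𝟙_L}`, then the free projection `x_e ↦ 1` off the block; Bürgisser's Rem. 2.7) restrict a certificate
`(h, NN_n · h)` to a certificate `(g, NN_b · g)` for an aligned block at additive cost, and — the point of this file — the
monomials of `g` are RESTRICTIONS TO THE BLOCK of monomials of `h` (`exists_prefix_transport_supp`,
`exists_suffix_transport_supp`, `exists_interval_transport_supp`, from the explicit transport `…LinearTransportExplicit`).
Hence `dim Newt(g)` is at most the dimension `D_B(h)` of the affine span of the block-restricted exponents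
`{u|_{arcs of B} : u ∈ supp h}`, and the descent runs INSIDE the block, where the directions of all other arcs were free:

* `exists_mem_support_of_mem_support_aeval` — support of a partial evaluation `x_e ↦ 1 (e ∉ K)`: every monomial of the
  result is the `K`-restriction of a monomial of the argument;
* ★ `exists_prefix_transport_supp` / `exists_suffix_transport_supp` / `exists_interval_transport_supp` — block transports
  with support control;
* `polylogArcFaces_qp_hard_scale` — the two-scale currency: faces of `NN_b` avoiding `|I|` arcs with
  `2(|I|+1)((log₂ N + c + 18)^{6(c+18)} + 3) ≤ b`, `b ≤ N`, beat `2^((log₂ N + c)^c)` (logs at the ambient scale `N`);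
* ★★ `blockNewtonDim_not_certificate_qp` — **for every `c`, eventually in `n = i + b + c'`: every `h ≠ 0` whose exponents
  restricted to the arcs of the aligned block `[2i, 2i+2b)` span an affine space of dimension `D` with
  `2(D+1)((log₂ n + c + 19)^{6(c+19)} + 3) ≤ b` satisfies `2^((log₂ n + c)^c) < L₊(NN_n · h) + L₊(h)`;**
  ★★ `blockNewtonDim_not_certificate_qp'` — the same with hypothesis `(D + 1)(log₂ n)^k ≤ b` for some `k = k(c)`:
  **CERTIFICATES HAVE NEWTON DIMENSION `≥ b/(log₂ n)^k` INSIDE EVERY ALIGNED BLOCK OF HALF-SIZE `b ≥ (log₂ n)^k`** — the case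
  `D = 0` is `…BlockAvoidance.intervalAvoiding_not_certificate_qp` (no variable internal to the block).

HONEST FRAMING: one more rung (local form of the Newton-dimension tier) toward ONE crux; stmt-21181 stays OPEN; nothing here
bears on `NNNotVP` or on VP ≠ VNP (NOT proved).  No definitions, no named facts.  References: Bürgisser 2000 Rem. 2.7
[Burgisser2000]; Hrubeš–Yehudayoff 2021 §6 Problem 2 [HrubesYehudayoff2021]; Jukna–Seiwert–Sergeev 2022 [JuknaSeiwertSergeev2022].
-/

noncomputable section

-- Sub = Summit single-conjunct layout: the duplicated namespace component is mandated by the tree.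
set_option linter.dupNamespace false
set_option autoImplicit false

namespace Summit.ValiantsHypothesis.ValiantsHypothesis.Theorems.FifoMatching.NNDivisionHard.BlockNewtonDimension

open Finset MvPolynomial Literature.Computability.AlgebraicComplexity
open Summit.ValiantsHypothesis.ValiantsHypothesis.Theorems.ZeroOneTransfer.Negative
  (topComponent topComponent_ne_zero support_topComponent_subset)
open Summit.ValiantsHypothesis.ValiantsHypothesis.Theorems.FifoMatching.NNDivisionHard.StackPowersQueue
  (blockEmb blockEmb_injective)
open Summit.ValiantsHypothesis.ValiantsHypothesis.Theorems.FifoMatching.NNDivisionHard.SplitFace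
  (lWeight blockEmbR two_mul_le blockEmbR_injective topComponent_lWeight
    support_rename_blockEmbR_outside support_rename_blockEmb_outside)
open Summit.ValiantsHypothesis.ValiantsHypothesis.Theorems.FifoMatching.NNDivisionHard.LinearTransport
  (exists_linear_transport_eq)
open Summit.ValiantsHypothesis.ValiantsHypothesis.Theorems.FifoMatching.NNDivisionHard.ManyArcFaces
  (halvingFaces_exp_lower_bound pow_add_three_mul_le add_le_mul_of_two_le)
open Summit.ValiantsHypothesis.ValiantsHypothesis.Theorems.FifoMatching.NNDivisionHard.BinomialPowers
  (absorb_arith absorb_exp)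
open Summit.ValiantsHypothesis.ValiantsHypothesis.Theorems.FifoMatching.NNDivisionHard.NewtonDimension
  (complexity_face_le_of_newtonDim)
open Summit.ValiantsHypothesis.ValiantsHypothesis.Theorems.FifoMatching.NNDivisionHard.PolylogArcFaces
  (lt_rpow_sixth_of_pow_lt polylog_absorb)
open scoped NNReal BigOperators

/-! ### §1 Support of a partial evaluation `x_e ↦ 1 (e ∉ K)` -/

section PartialEval

variable {σ : Type*}

/-- Every monomial of `q|_{x_e := 1 (e ∉ K)}` is the `K`-restriction of a monomial of `q`. [folklore] -/
theorem exists_mem_support_of_mem_support_aeval (K : Set σ) (a : σ → MvPolynomial σ ℝ≥0)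
    (hK : ∀ e, e ∈ K → a e = X e) (hK' : ∀ e, e ∉ K → a e = 1) (q : MvPolynomial σ ℝ≥0)
    {d : σ →₀ ℕ} (hd : d ∈ (aeval a q).support) : ∃ m ∈ q.support, ∀ e ∈ K, d e = m e := by
  classical
  have hmono : ∀ (m : σ →₀ ℕ) (c : ℝ≥0), aeval a (monomial m c) = monomial (m.filter (fun e => e ∈ K)) c := by
    intro m c
    rw [aeval_monomial, algebraMap_eq, Finsupp.prod,
      ← Finset.prod_filter_mul_prod_filter_not m.support (fun e => e ∈ K)]
    have h1 : ∏ e ∈ m.support.filter (fun e => ¬ e ∈ K), a e ^ m e = 1 :=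
      Finset.prod_eq_one fun e he => by rw [hK' e (Finset.mem_filter.1 he).2, one_pow]
    have h2 : ∏ e ∈ m.support.filter (fun e => e ∈ K), a e ^ m e =
        ∏ e ∈ m.support.filter (fun e => e ∈ K), X e ^ m e :=
      Finset.prod_congr rfl fun e he => by rw [hK e (Finset.mem_filter.1 he).2]
    rw [h1, h2, mul_one, monomial_eq, Finsupp.prod, Finsupp.support_filter]
    refine congrArg _ (Finset.prod_congr rfl fun e he => ?_)
    rw [Finsupp.filter_apply_pos _ _ (Finset.mem_filter.1 he).2]
  have hsum : aeval a q = ∑ m ∈ q.support, monomial (m.filter (fun e => e ∈ K)) (coeff m q) := by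
    conv_lhs => rw [q.as_sum]
    rw [map_sum]
    exact Finset.sum_congr rfl fun m _ => hmono m (coeff m q)
  rw [hsum] at hd
  obtain ⟨m, hm, hdm⟩ := Finset.mem_biUnion.1 (support_sum hd)
  have hd' : d = m.filter (fun e => e ∈ K) := by
    have := support_monomial_subset hdm
    rwa [Finset.mem_singleton] at this
  exact ⟨m, hm, fun e he => by rw [hd', Finsupp.filter_apply_pos _ _ he]⟩

/-- Support control of the explicit transport: if `rename ι g = q|_{x_e := 1 (e ∉ range ι)}` then every monomial of `g` is
the pull-back along `ι` of a monomial of `q`. [folklore] -/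
theorem exists_mem_support_of_rename_eq_aeval {τ : Type*} {ι : τ → σ} (hι : Function.Injective ι)
    (a : σ → MvPolynomial σ ℝ≥0) (hK : ∀ e, e ∈ Set.range ι → a e = X e) (hK' : ∀ e, e ∉ Set.range ι → a e = 1)
    {q : MvPolynomial σ ℝ≥0} {g : MvPolynomial τ ℝ≥0} (hg : rename ι g = aeval a q) :
    ∀ d ∈ g.support, ∃ m ∈ q.support, ∀ t : τ, d t = m (ι t) := by
  classical
  intro d hd
  have hd' : Finsupp.mapDomain ι d ∈ (aeval a q).support := by
    rw [← hg, support_rename_of_injective hι]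
    exact Finset.mem_image_of_mem _ hd
  obtain ⟨m, hm, hdm⟩ := exists_mem_support_of_mem_support_aeval (Set.range ι) a hK hK' q hd'
  exact ⟨m, hm, fun t => by rw [← hdm (ι t) ⟨t, rfl⟩, Finsupp.mapDomain_apply hι]⟩

end PartialEval

/-! ### §2 Block transports with support control -/

section Blocks

variable {b c : ℕ}

/-- ★ **PREFIX TRANSPORT WITH SUPPORT CONTROL.**  Every certificate `(h, NN_{b+c} · h)` restricts to `(g, NN_b · g)`, `g ≠ 0`,
`L₊(NN_b · g) ≤ L₊(NN_{b+c} · h) + 1`, `L₊(g) ≤ L₊(h)`, AND every monomial of `g` is the restriction to the prefix block of a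
monomial of `h`. [cite: Burgisser2000, Rem. 2.7] -/
theorem exists_prefix_transport_supp {h : MvPolynomial (Fin (2 * (b + c)) × Fin (2 * (b + c))) ℝ≥0} (hh : h ≠ 0) :
    ∃ g : MvPolynomial (Fin (2 * b) × Fin (2 * b)) ℝ≥0, g ≠ 0 ∧
      complexity (nestFreeMatchingPoly b ℝ≥0 * g) ≤ complexity (nestFreeMatchingPoly (b + c) ℝ≥0 * h) + 1 ∧
      complexity g ≤ complexity h ∧
      ∀ d ∈ g.support, ∃ m ∈ h.support, ∀ t, d t = m (blockEmb (two_mul_le b c) t) := by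
  classical
  let a : Fin (2 * (b + c)) × Fin (2 * (b + c)) → MvPolynomial (Fin (2 * (b + c)) × Fin (2 * (b + c))) ℝ≥0 :=
    fun e => if e ∈ Set.range (blockEmb (two_mul_le b c)) then X e else 1
  have hK : ∀ e, e ∈ Set.range (blockEmb (two_mul_le b c)) → a e = X e := fun e he => by simp only [a, if_pos he]
  have hK' : ∀ e, e ∉ Set.range (blockEmb (two_mul_le b c)) → a e = 1 := fun e he => by simp only [a, if_neg he]
  obtain ⟨g, hg0, h1, h2, hg⟩ := exists_linear_transport_eq (blockEmb_injective (two_mul_le b c)) (lWeight b c)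
    topComponent_lWeight
    (fun h0 => MonomialCofactor.nn_ne_zero c (rename_injective _ blockEmbR_injective (by rw [h0, map_zero])))
    (support_rename_blockEmbR_outside _) a hK hK' hh
  refine ⟨g, hg0, h1, h2, fun d hd => ?_⟩
  obtain ⟨m, hm, hdm⟩ := exists_mem_support_of_rename_eq_aeval (blockEmb_injective (two_mul_le b c)) a hK hK' hg d hd
  exact ⟨m, support_topComponent_subset _ h hm, hdm⟩

/-- ★ **SUFFIX TRANSPORT WITH SUPPORT CONTROL.** [cite: Burgisser2000, Rem. 2.7] -/
theorem exists_suffix_transport_supp {h : MvPolynomial (Fin (2 * (b + c)) × Fin (2 * (b + c))) ℝ≥0} (hh : h ≠ 0) :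
    ∃ g : MvPolynomial (Fin (2 * c) × Fin (2 * c)) ℝ≥0, g ≠ 0 ∧
      complexity (nestFreeMatchingPoly c ℝ≥0 * g) ≤ complexity (nestFreeMatchingPoly (b + c) ℝ≥0 * h) + 1 ∧
      complexity g ≤ complexity h ∧
      ∀ d ∈ g.support, ∃ m ∈ h.support, ∀ t, d t = m (blockEmbR b c t) := by
  classical
  let a : Fin (2 * (b + c)) × Fin (2 * (b + c)) → MvPolynomial (Fin (2 * (b + c)) × Fin (2 * (b + c))) ℝ≥0 :=
    fun e => if e ∈ Set.range (blockEmbR b c) then X e else 1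
  have hK : ∀ e, e ∈ Set.range (blockEmbR b c) → a e = X e := fun e he => by simp only [a, if_pos he]
  have hK' : ∀ e, e ∉ Set.range (blockEmbR b c) → a e = 1 := fun e he => by simp only [a, if_neg he]
  obtain ⟨g, hg0, h1, h2, hg⟩ := exists_linear_transport_eq blockEmbR_injective (lWeight b c)
    (topComponent_lWeight.trans (mul_comm _ _))
    (fun h0 => MonomialCofactor.nn_ne_zero b
      (rename_injective _ (blockEmb_injective (two_mul_le b c)) (by rw [h0, map_zero])))
    (support_rename_blockEmb_outside _) a hK hK' hh
  refine ⟨g, hg0, h1, h2, fun d hd => ?_⟩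
  obtain ⟨m, hm, hdm⟩ := exists_mem_support_of_rename_eq_aeval blockEmbR_injective a hK hK' hg d hd
  exact ⟨m, support_topComponent_subset _ h hm, hdm⟩

/-- ★ **INTERVAL TRANSPORT WITH SUPPORT CONTROL**: to the aligned block `[2i, 2i+2b)` of `[0, 2(i+b+c))`, at additive cost
`+2`, every monomial of the transported cofactor being the block-restriction of a monomial of `h`. [cite: Burgisser2000, Rem. 2.7] -/
theorem exists_interval_transport_supp {i : ℕ}
    {h : MvPolynomial (Fin (2 * (i + (b + c))) × Fin (2 * (i + (b + c)))) ℝ≥0} (hh : h ≠ 0) :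
    ∃ g : MvPolynomial (Fin (2 * b) × Fin (2 * b)) ℝ≥0, g ≠ 0 ∧
      complexity (nestFreeMatchingPoly b ℝ≥0 * g) ≤ complexity (nestFreeMatchingPoly (i + (b + c)) ℝ≥0 * h) + 2 ∧
      complexity g ≤ complexity h ∧
      ∀ d ∈ g.support, ∃ m ∈ h.support, ∀ t, d t = m (blockEmbR i (b + c) (blockEmb (two_mul_le b c) t)) := by
  obtain ⟨g₁, h1, h2, h3, h4⟩ := exists_suffix_transport_supp (b := i) (c := b + c) hh
  obtain ⟨g, h5, h6, h7, h8⟩ := exists_prefix_transport_supp (b := b) (c := c) h1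
  refine ⟨g, h5, h6.trans (by omega), h7.trans h3, fun d hd => ?_⟩
  obtain ⟨m₁, hm₁, hdm₁⟩ := h8 d hd
  obtain ⟨m, hm, hmm⟩ := h4 m₁ hm₁
  exact ⟨m, hm, fun t => by rw [hdm₁, hmm]⟩

end Blocks

/-! ### §3 The two-scale currency: faces at scale `b`, logarithms at the ambient scale `N ≥ b` -/

/-- **FACES AVOIDING UP TO `b / polylog N` ARCS AT SCALE `b ≤ N`.**  For every `c`, eventually in `N`: for every `b ≤ N`,
every arc set `I` of `[0,2b)` with `2 (|I| + 1) ((log₂ N + c + 18)^{6(c+18)} + 3) ≤ b` and every `L`,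
`L₊(NN_b^{¬I}) ≤ 16 ((2b+1)(L+2))² ⇒ 2^((log₂ N + c)^c) < L`. [cite: HrubesYehudayoff2021, §6 Problem 2] -/
theorem polylogArcFaces_qp_hard_scale (c : ℕ) : ∃ n₀ : ℕ, ∀ N : ℕ, n₀ ≤ N → ∀ b : ℕ, b ≤ N →
    ∀ I : Finset (Fin (2 * b) × Fin (2 * b)),
      2 * (I.card + 1) * ((Nat.log 2 N + (c + 18)) ^ (6 * (c + 18)) + 3) ≤ b → ∀ L : ℕ,
    complexity (∑ M ∈ (nestFreeMatchings (2 * b)).filter (fun M => ∀ j ∈ openers M, (j, M j) ∉ I),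
      arcMonomial ℝ≥0 M) ≤ 16 * ((2 * b + 1) * (L + 2)) ^ 2 → 2 ^ ((Nat.log 2 N + c) ^ c) < L := by
  set K : ℕ := c + 14 with hK
  obtain ⟨nE, hrec⟩ := halvingFaces_exp_lower_bound
  refine ⟨max (2 ^ (nE + 16)) 2, fun N hN b hbN I hI L hface0 => ?_⟩
  have hn1 : 2 ^ (nE + 16) ≤ N := le_trans (le_max_left _ _) hN
  have hn2 : 2 ≤ N := le_trans (le_max_right _ _) hN
  set F := complexity (∑ M ∈ (nestFreeMatchings (2 * b)).filter (fun M => ∀ j ∈ openers M, (j, M j) ∉ I),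
      arcMonomial ℝ≥0 M) with hF
  have hface : F ≤ 16 * ((2 * N + 1) * (L + 2)) ^ 2 :=
    hface0.trans (Nat.mul_le_mul_left 16 (Nat.pow_le_pow_left (Nat.mul_le_mul_right _ (by omega)) 2))
  -- the polylog of the hypothesis is `T⁶`, `T = (log₂ N + K + 4)^(K + 4)`
  have hT6 : (Nat.log 2 N + (c + 18)) ^ (6 * (c + 18)) = ((Nat.log 2 N + (K + 4)) ^ (K + 4)) ^ 6 := by
    rw [← pow_mul, hK, show c + 14 + 4 = c + 18 by ring, Nat.mul_comm]
  -- the number of rounds: `|I| < 2^r ≤ 2 (|I| + 1)`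
  set r : ℕ := Nat.log 2 (I.card + 1) + 1 with hr
  have hr1 : I.card + 1 < 2 ^ r := Nat.lt_pow_succ_log_self one_lt_two _
  have hr2 : 2 ^ r ≤ 2 * (I.card + 1) := by
    rw [hr, pow_succ]
    have := Nat.pow_log_le_self 2 (show I.card + 1 ≠ 0 by omega)
    omega
  -- size condition `2^r (nE + 16) ≤ b`
  have hlog : nE + 16 ≤ Nat.log 2 N := (Nat.le_log_iff_pow_le one_lt_two (by omega)).2 hn1
  have hpoly : nE + 16 ≤ (Nat.log 2 N + (c + 18)) ^ (6 * (c + 18)) + 3 := by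
    have h1 : Nat.log 2 N ≤ (Nat.log 2 N + (c + 18)) ^ (6 * (c + 18)) :=
      calc Nat.log 2 N ≤ Nat.log 2 N + (c + 18) := Nat.le_add_right _ _
        _ = (Nat.log 2 N + (c + 18)) ^ 1 := (pow_one _).symm
        _ ≤ (Nat.log 2 N + (c + 18)) ^ (6 * (c + 18)) := Nat.pow_le_pow_right (by omega) (by omega)
    omega
  have hsize : 2 ^ r * (nE + 16) ≤ b :=
    calc 2 ^ r * (nE + 16) ≤ 2 * (I.card + 1) * ((Nat.log 2 N + (c + 18)) ^ (6 * (c + 18)) + 3) :=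
          Nat.mul_le_mul hr2 hpoly
      _ ≤ b := hI
  obtain ⟨m, hm, hexp⟩ := hrec r b hsize I (by omega)
  -- `m > T⁶`
  have hmT : ((Nat.log 2 N + (K + 4)) ^ (K + 4)) ^ 6 < m := by
    rw [← hT6]
    have h1 : b < 2 * (I.card + 1) * (m + 2) := lt_of_lt_of_le hm (Nat.mul_le_mul_right _ hr2)
    have h2 : 2 * (I.card + 1) * ((Nat.log 2 N + (c + 18)) ^ (6 * (c + 18)) + 3) <
        2 * (I.card + 1) * (m + 2) := lt_of_le_of_lt hI h1
    have h3 := Nat.lt_of_mul_lt_mul_left h2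
    omega
  have h2 : (((Nat.log 2 N + (K + 4)) ^ (K + 4) : ℕ) : ℝ) < (m : ℝ) ^ ((1 : ℝ) / 6) :=
    lt_rpow_sixth_of_pow_lt hmT
  -- `3r ≤ 3 (log₂ N + 1)`
  have hr3 : r ≤ Nat.log 2 N + 1 := by
    rw [hr]
    have h0 : 2 * (I.card + 1) ≤ 2 * (I.card + 1) * ((Nat.log 2 N + (c + 18)) ^ (6 * (c + 18)) + 3) :=
      Nat.le_mul_of_pos_right _ (by omega)
    have h1 : I.card + 1 ≤ N := by omega
    have : Nat.log 2 (I.card + 1) ≤ Nat.log 2 N := Nat.log_mono_right h1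
    omega
  by_contra hle
  push Not at hle
  have e1 := absorb_arith N c L hle
  have e3 : 2 ^ (2 * (Nat.log 2 N + c) ^ c + 2 * Nat.log 2 N + 13) ≤ 2 ^ ((Nat.log 2 N + K) ^ K) :=
    Nat.pow_le_pow_right (by norm_num) (absorb_exp (Nat.log 2 N) c)
  have h7 := e1.trans e3
  -- `(ℓ + K)^K + 3r + 2 ≤ (ℓ + K + 4)^(K + 4)`
  have hp : (Nat.log 2 N + K) ^ K + 3 * r + 2 ≤ (Nat.log 2 N + (K + 4)) ^ (K + 4) := by
    have hx : 1 ≤ Nat.log 2 N + K := by omega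
    have h1 := pow_add_three_mul_le (Nat.log 2 N + K) K hx (by omega)
    have ha : (Nat.log 2 N + K + 3) ^ (K + 1) ≤ (Nat.log 2 N + (K + 4)) ^ (K + 1) :=
      Nat.pow_le_pow_left (by omega) _
    have hc3 : 3 ≤ (Nat.log 2 N + (K + 4)) ^ 3 :=
      calc 3 ≤ 3 ^ 1 := by norm_num
        _ ≤ (Nat.log 2 N + (K + 4)) ^ 1 := Nat.pow_le_pow_left (by omega) 1
        _ ≤ (Nat.log 2 N + (K + 4)) ^ 3 := Nat.pow_le_pow_right (by omega) (by norm_num)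
    have h2 : (Nat.log 2 N + (K + 4)) ^ (K + 1) * 3 ≤ (Nat.log 2 N + (K + 4)) ^ (K + 4) :=
      calc (Nat.log 2 N + (K + 4)) ^ (K + 1) * 3
          ≤ (Nat.log 2 N + (K + 4)) ^ (K + 1) * (Nat.log 2 N + (K + 4)) ^ 3 := Nat.mul_le_mul_left _ hc3
        _ = (Nat.log 2 N + (K + 4)) ^ (K + 4) := by rw [← pow_add]
    have h3 : 3 * r ≤ 3 * (Nat.log 2 N + K) := by omega
    omega
  -- abbreviate the big quantities
  obtain ⟨X, hX⟩ : ∃ X : ℕ, ((2 * N + 1) * (L + 2)) ^ 2 = X := ⟨_, rfl⟩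
  obtain ⟨P, hP⟩ : ∃ P : ℕ, 2 ^ ((Nat.log 2 N + K) ^ K) = P := ⟨_, rfl⟩
  obtain ⟨Q, hQ⟩ : ∃ Q : ℕ, 2 ^ (3 * r + 2) = Q := ⟨_, rfl⟩
  have hX1 : 1 ≤ X := by
    rw [← hX]; exact Nat.one_le_pow _ _ (Nat.mul_pos (by omega) (by omega))
  rw [hX, hP] at h7
  rw [hX] at hface
  have hP2 : 2 ≤ P := by omega
  have hQ2 : 2 ≤ Q := by
    rw [← hQ]
    calc 2 = 2 ^ 1 := (pow_one 2).symm
      _ ≤ 2 ^ (3 * r + 2) := Nat.pow_le_pow_right (by norm_num) (by omega)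
  have hQr : 3 * r + 1 ≤ Q := by
    rw [← hQ]
    have := Nat.lt_two_pow_self (n := 3 * r + 2)
    omega
  have key : P + Q ≤ P * Q := add_le_mul_of_two_le P Q hP2 hQ2
  have h8 : 16 * X + 3 * r + 1 ≤ 2 ^ ((Nat.log 2 N + (K + 4)) ^ (K + 4)) :=
    calc 16 * X + 3 * r + 1 ≤ P + Q := by omega
      _ ≤ P * Q := key
      _ = 2 ^ ((Nat.log 2 N + K) ^ K + 3 * r + 2) := by rw [← hP, ← hQ]; ring
      _ ≤ 2 ^ ((Nat.log 2 N + (K + 4)) ^ (K + 4)) := Nat.pow_le_pow_right (by norm_num) hp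
  have h3 : (2 : ℝ) ^ ((((Nat.log 2 N + (K + 4)) ^ (K + 4) : ℕ) : ℝ)) < (2 : ℝ) ^ ((m : ℝ) ^ ((1 : ℝ) / 6)) :=
    Real.rpow_lt_rpow_of_exponent_lt (by norm_num) h2
  have h4 : ((2 ^ ((Nat.log 2 N + (K + 4)) ^ (K + 4)) : ℕ) : ℝ) < ((F + 3 * r : ℕ) : ℝ) := by
    rw [Nat.cast_pow, Nat.cast_ofNat, ← Real.rpow_natCast]
    exact h3.trans_le hexp
  have h5 : 2 ^ ((Nat.log 2 N + (K + 4)) ^ (K + 4)) < F + 3 * r := by exact_mod_cast h4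
  have h9 : F + 3 * r < 16 * X + 3 * r + 1 := by omega
  exact absurd (lt_trans h5 (lt_of_lt_of_le h9 h8)) (lt_irrefl _)

/-! ### §4 The local tier -/

/-- `2^((ℓ + c)^c) + 2 ≤ 2^((ℓ + (c+1))^(c+1))` for `ℓ ≥ 1` (one more unit of `c` absorbs an additive constant). [folklore] -/
theorem two_pow_polylog_succ (ℓ c : ℕ) (hℓ : 1 ≤ ℓ) :
    2 ^ ((ℓ + c) ^ c) + 2 ≤ 2 ^ ((ℓ + (c + 1)) ^ (c + 1)) := by
  have h1 : (ℓ + c) ^ c + 1 ≤ (ℓ + (c + 1)) ^ (c + 1) := by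
    have ha : (ℓ + c) ^ c ≤ (ℓ + (c + 1)) ^ c := Nat.pow_le_pow_left (by omega) c
    have hb : 1 ≤ (ℓ + (c + 1)) ^ c := Nat.one_le_pow _ _ (by omega)
    calc (ℓ + c) ^ c + 1 ≤ (ℓ + (c + 1)) ^ c + (ℓ + (c + 1)) ^ c := Nat.add_le_add ha hb
      _ = (ℓ + (c + 1)) ^ c * 2 := by ring
      _ ≤ (ℓ + (c + 1)) ^ c * (ℓ + (c + 1)) := Nat.mul_le_mul_left _ (by omega)
      _ = (ℓ + (c + 1)) ^ (c + 1) := by ring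
  have h2 : 1 ≤ (ℓ + c) ^ c := Nat.one_le_pow _ _ (by omega)
  have h3 : 2 ≤ 2 ^ ((ℓ + c) ^ c) :=
    calc 2 = 2 ^ 1 := (pow_one 2).symm
      _ ≤ 2 ^ ((ℓ + c) ^ c) := Nat.pow_le_pow_right (by norm_num) h2
  calc 2 ^ ((ℓ + c) ^ c) + 2 ≤ 2 ^ ((ℓ + c) ^ c) + 2 ^ ((ℓ + c) ^ c) := by omega
    _ = 2 ^ ((ℓ + c) ^ c + 1) := by ring
    _ ≤ 2 ^ ((ℓ + (c + 1)) ^ (c + 1)) := Nat.pow_le_pow_right (by norm_num) h1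

/-- ★★ **LOCAL NEWTON DIMENSION.**  For every `c`, eventually in `n = i + (b + c')`: every `h ≠ 0` whose exponents restricted
to the arcs of the aligned block `[2i, 2i+2b)` span (in `ℚ^{arcs of the block}`) an affine space of dimension `D` with
`2 (D + 1) ((log₂ n + c + 19)^{6(c+19)} + 3) ≤ b` satisfies `2^((log₂ n + c)^c) < L₊(NN_n · h) + L₊(h)`.
[cite: Burgisser2000, Rem. 2.7] [cite: HrubesYehudayoff2021, §6 Problem 2] [cite: JuknaSeiwertSergeev2022, Thm 1] -/
theorem blockNewtonDim_not_certificate_qp (c : ℕ) : ∃ n₀ : ℕ, ∀ i b c' : ℕ, n₀ ≤ i + (b + c') →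
    ∀ h : MvPolynomial (Fin (2 * (i + (b + c'))) × Fin (2 * (i + (b + c')))) ℝ≥0, h ≠ 0 →
      2 * (Module.finrank ℚ (vectorSpan ℚ ((fun u : (Fin (2 * (i + (b + c'))) × Fin (2 * (i + (b + c')))) →₀ ℕ =>
        fun t : Fin (2 * b) × Fin (2 * b) => (u (blockEmbR i (b + c') (blockEmb (two_mul_le b c') t)) : ℚ)) ''
          (h.support : Set ((Fin (2 * (i + (b + c'))) × Fin (2 * (i + (b + c')))) →₀ ℕ)))) + 1) *
        ((Nat.log 2 (i + (b + c')) + (c + 1 + 18)) ^ (6 * (c + 1 + 18)) + 3) ≤ b →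
      2 ^ ((Nat.log 2 (i + (b + c')) + c) ^ c) <
        complexity (nestFreeMatchingPoly (i + (b + c')) ℝ≥0 * h) + complexity h := by
  obtain ⟨n₀, hn₀⟩ := polylogArcFaces_qp_hard_scale (c + 1)
  refine ⟨max n₀ 2, fun i b c' hn h hh hD => ?_⟩
  have hn2 : 2 ≤ i + (b + c') := le_trans (le_max_right _ _) hn
  obtain ⟨g, hg0, hg1, hg2, hgsupp⟩ := exists_interval_transport_supp (i := i) (b := b) (c := c') hh
  have hsub : ((fun u : (Fin (2 * b) × Fin (2 * b)) →₀ ℕ => fun a : Fin (2 * b) × Fin (2 * b) => (u a : ℚ)) ''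
        (g.support : Set ((Fin (2 * b) × Fin (2 * b)) →₀ ℕ))) ⊆
      ((fun u : (Fin (2 * (i + (b + c'))) × Fin (2 * (i + (b + c')))) →₀ ℕ =>
        fun t : Fin (2 * b) × Fin (2 * b) => (u (blockEmbR i (b + c') (blockEmb (two_mul_le b c') t)) : ℚ)) ''
          (h.support : Set ((Fin (2 * (i + (b + c'))) × Fin (2 * (i + (b + c')))) →₀ ℕ))) := by
    rintro p ⟨d, hd, rfl⟩
    obtain ⟨m, hm, hdm⟩ := hgsupp d (Finset.mem_coe.1 hd)
    refine ⟨m, Finset.mem_coe.2 hm, funext fun t => ?_⟩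
    simp only [hdm t]
  have hdim := Submodule.finrank_mono (vectorSpan_mono ℚ hsub)
  have hb3 : 3 ≤ b := by
    have h6 : 2 * 1 * 3 ≤ 2 * (Module.finrank ℚ (vectorSpan ℚ
        ((fun u : (Fin (2 * (i + (b + c'))) × Fin (2 * (i + (b + c')))) →₀ ℕ =>
          fun t : Fin (2 * b) × Fin (2 * b) => (u (blockEmbR i (b + c') (blockEmb (two_mul_le b c') t)) : ℚ)) ''
            (h.support : Set ((Fin (2 * (i + (b + c'))) × Fin (2 * (i + (b + c')))) →₀ ℕ)))) + 1) *
        ((Nat.log 2 (i + (b + c')) + (c + 1 + 18)) ^ (6 * (c + 1 + 18)) + 3) :=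
      Nat.mul_le_mul (Nat.mul_le_mul_left 2 (Nat.le_add_left 1 _)) (Nat.le_add_left 3 _)
    omega
  obtain ⟨I, hIcard, -, hface⟩ := complexity_face_le_of_newtonDim hb3 hg0
  have hID : I.card ≤ Module.finrank ℚ (vectorSpan ℚ
      ((fun u : (Fin (2 * (i + (b + c'))) × Fin (2 * (i + (b + c')))) →₀ ℕ =>
        fun t : Fin (2 * b) × Fin (2 * b) => (u (blockEmbR i (b + c') (blockEmb (two_mul_le b c') t)) : ℚ)) ''
          (h.support : Set ((Fin (2 * (i + (b + c'))) × Fin (2 * (i + (b + c')))) →₀ ℕ)))) := hIcard.trans hdim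
  have hI : 2 * (I.card + 1) * ((Nat.log 2 (i + (b + c')) + (c + 1 + 18)) ^ (6 * (c + 1 + 18)) + 3) ≤ b :=
    le_trans (Nat.mul_le_mul_right _ (Nat.mul_le_mul_left 2 (Nat.add_le_add_right hID 1))) hD
  have hface' : complexity (∑ M ∈ (nestFreeMatchings (2 * b)).filter (fun M => ∀ j ∈ openers M, (j, M j) ∉ I),
      arcMonomial ℝ≥0 M) ≤
      16 * ((2 * b + 1) * ((complexity (nestFreeMatchingPoly (i + (b + c')) ℝ≥0 * h) + 2) + 2)) ^ 2 := by
    refine hface.trans (Nat.mul_le_mul_left 16 (Nat.pow_le_pow_left (Nat.mul_le_mul_left _ ?_) 2))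
    exact Nat.add_le_add_right hg1 2
  have H := hn₀ (i + (b + c')) (le_trans (le_max_left _ _) hn) b (by omega) I hI _ hface'
  have hℓ : 1 ≤ Nat.log 2 (i + (b + c')) :=
    (Nat.le_log_iff_pow_le one_lt_two (by omega)).2 (by rw [pow_one]; exact hn2)
  have hsucc := two_pow_polylog_succ (Nat.log 2 (i + (b + c'))) c hℓ
  have hpos : complexity (nestFreeMatchingPoly (i + (b + c')) ℝ≥0 * h) ≤
      complexity (nestFreeMatchingPoly (i + (b + c')) ℝ≥0 * h) + complexity h := Nat.le_add_right _ _
  omega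

/-- ★★ **The same, `∃ k` form: CERTIFICATES HAVE NEWTON DIMENSION `≥ b/(log₂ n)^k` INSIDE EVERY ALIGNED BLOCK of half-size
`b`** — for every `c` there are `k` and `n₀` with: for all `n = i + (b + c') ≥ n₀`, every `h ≠ 0` whose block Newton dimension
`D` (block `[2i, 2i+2b)`) has `(D + 1)(log₂ n)^k ≤ b` satisfies `2^((log₂ n + c)^c) < L₊(NN_n · h) + L₊(h)`.
[cite: HrubesYehudayoff2021, §6 Problem 2] -/
theorem blockNewtonDim_not_certificate_qp' (c : ℕ) : ∃ k n₀ : ℕ, ∀ i b c' : ℕ, n₀ ≤ i + (b + c') →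
    ∀ h : MvPolynomial (Fin (2 * (i + (b + c'))) × Fin (2 * (i + (b + c')))) ℝ≥0, h ≠ 0 →
      (Module.finrank ℚ (vectorSpan ℚ ((fun u : (Fin (2 * (i + (b + c'))) × Fin (2 * (i + (b + c')))) →₀ ℕ =>
        fun t : Fin (2 * b) × Fin (2 * b) => (u (blockEmbR i (b + c') (blockEmb (two_mul_le b c') t)) : ℚ)) ''
          (h.support : Set ((Fin (2 * (i + (b + c'))) × Fin (2 * (i + (b + c')))) →₀ ℕ)))) + 1) *
        (Nat.log 2 (i + (b + c'))) ^ k ≤ b →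
      2 ^ ((Nat.log 2 (i + (b + c')) + c) ^ c) <
        complexity (nestFreeMatchingPoly (i + (b + c')) ℝ≥0 * h) + complexity h := by
  obtain ⟨n₀, hn₀⟩ := blockNewtonDim_not_certificate_qp c
  obtain ⟨l₀, hl₀⟩ := polylog_absorb (c + 1)
  refine ⟨6 * (c + 1 + 18) + 1, max n₀ (2 ^ l₀), fun i b c' hn h hh hD =>
    hn₀ i b c' (le_trans (le_max_left _ _) hn) h hh ?_⟩
  have hn' : 2 ^ l₀ ≤ i + (b + c') := le_trans (le_max_right _ _) hn
  have hl : l₀ ≤ Nat.log 2 (i + (b + c')) :=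
    (Nat.le_log_iff_pow_le one_lt_two (by have := Nat.one_le_two_pow (n := l₀); omega)).2 hn'
  set D := Module.finrank ℚ (vectorSpan ℚ ((fun u : (Fin (2 * (i + (b + c'))) × Fin (2 * (i + (b + c')))) →₀ ℕ =>
        fun t : Fin (2 * b) × Fin (2 * b) => (u (blockEmbR i (b + c') (blockEmb (two_mul_le b c') t)) : ℚ)) ''
          (h.support : Set ((Fin (2 * (i + (b + c'))) × Fin (2 * (i + (b + c')))) →₀ ℕ)))) with hDdef
  calc 2 * (D + 1) * ((Nat.log 2 (i + (b + c')) + (c + 1 + 18)) ^ (6 * (c + 1 + 18)) + 3)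
      = (D + 1) * (2 * ((Nat.log 2 (i + (b + c')) + (c + 1 + 18)) ^ (6 * (c + 1 + 18)) + 3)) := by
        rw [Nat.mul_comm 2 (D + 1), Nat.mul_assoc]
    _ ≤ (D + 1) * (Nat.log 2 (i + (b + c'))) ^ (6 * (c + 1 + 18) + 1) := Nat.mul_le_mul_left _ (hl₀ _ hl)
    _ ≤ b := hD

end Summit.ValiantsHypothesis.ValiantsHypothesis.Theorems.FifoMatching.NNDivisionHard.BlockNewtonDimension

end
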